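import Summits.CriticalPhenomena.PercolationContinuityZ3.Theorems.PercNearOneGluingNoHeavyQuantFarGate3Count
import HarnessLib

/-!
# QUANT lane R8, front "FAR beyond trees", layer one — THE DEGREE-THREE GATE AT THE OBSERVER, IX: the pointwise mean bound (`sub`)

builds on p205010 (kernel theorem, internal audit signed; external expert review pending)

Support file (`--supports stmt-CriticalPhenomena-4575`), seat `prim-quant-p1` (gen 28); memo
`run/shared/lean/prim/quant/prim-quant-p1-g28/FOR-LEAD-GATE3.md` §1 (the `sub` column), §7.  Pure combinatorics (no measure); standard
axioms; no sorries; no definitions.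

For an off-`v` configuration `η`, a finset `B` of outside relays (`n = |B|`), `K = #{b ∈ B : o ~ b}`, the feedback counts
`F₁ = #{b : o ≁ b, u₁ ~ b}`, `F₂ = #{b : o ≁ b, u₂ ~ b}`, `F = #{b : o ≁ b, u₁ ~ b ∨ u₂ ~ b}` and the events `G₁ = [o ~ u₁]`, `G₂ = [o ~ u₂]`,
`H = [u₁ ~ u₂]`, the conditional mean of the observer's outside count given `η` is (file X)
`K + p r₁r₂·F + p r₁(1−r₂)·F₁ + p(1−r₁)r₂·F₂ + (1−p)r₁r₂·[G₁∨G₂]·F`.  **`Gate3.sub_pointwise`** bounds it by the `sub` column of the reduced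
LP: `Σ_T (f_T·n·[T ∧ K=0] + (1 + f_T(n−1))·[T ∧ K=1] + n·[T ∧ K≥2])` over the five types (14 cells), with feed rates `f₀ = p·max(r₁,r₂)` (`T₀ = ¬G₁∧¬G₂∧¬H`),
`f₁ = (1−(1−p)(1−r₁))r₂` (`T₁ = G₁∧¬G₂`), `f₂` (mirror), `f₃ = p(1−(1−r₁)(1−r₂))` (`T₃ = ¬G₁∧¬G₂∧H`), `f₄ = 0` (`T₄ = G₁∧G₂`) — via the
feedback-count relations per type (`Gate3.feed_rel_*`) and `Gate3.count_le`.  [cite: Grimmett1999, §1.3 p. 10]; [this work].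
-/

namespace Summit.CriticalPhenomena.PercolationContinuityZ3.Theorems

namespace Quant

namespace Gate3

open Finset
open Literature.Probability.Percolation
open scoped Classical

variable {n : ℕ} {o u₁ u₂ : Fin n}

/-! ## Feedback-count relations per type -/

/-- `F₁ ≤ F` and `F₂ ≤ F`. [this work] -/
theorem feed_le_feed (η : BondConfig (Fin n)) (B : Finset (Fin n)) :
    (B.filter fun b => ¬ (openGraph η).Reachable o b ∧ (openGraph η).Reachable u₁ b).card ≤
        (B.filter fun b => ¬ (openGraph η).Reachable o b ∧ ((openGraph η).Reachable u₁ b ∨ (openGraph η).Reachable u₂ b)).card ∧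
      (B.filter fun b => ¬ (openGraph η).Reachable o b ∧ (openGraph η).Reachable u₂ b).card ≤
        (B.filter fun b => ¬ (openGraph η).Reachable o b ∧ ((openGraph η).Reachable u₁ b ∨ (openGraph η).Reachable u₂ b)).card := by
  constructor
  · exact card_le_card fun b hb => by
      simp only [mem_filter] at hb ⊢; exact ⟨hb.1, hb.2.1, Or.inl hb.2.2⟩
  · exact card_le_card fun b hb => by
      simp only [mem_filter] at hb ⊢; exact ⟨hb.1, hb.2.1, Or.inr hb.2.2⟩

/-- Off `H`: `F₁ + F₂ = F` (a relay joined to both `u₁` and `u₂` joins them). [this work] -/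
theorem feed_add_eq_of_not_H (η : BondConfig (Fin n)) (B : Finset (Fin n)) (hH : ¬ (openGraph η).Reachable u₁ u₂) :
    (B.filter fun b => ¬ (openGraph η).Reachable o b ∧ (openGraph η).Reachable u₁ b).card +
        (B.filter fun b => ¬ (openGraph η).Reachable o b ∧ (openGraph η).Reachable u₂ b).card =
      (B.filter fun b => ¬ (openGraph η).Reachable o b ∧ ((openGraph η).Reachable u₁ b ∨ (openGraph η).Reachable u₂ b)).card := by
  rw [← card_union_of_disjoint]
  · congr 1
    ext b
    simp only [mem_union, mem_filter]
    tauto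
  · rw [disjoint_filter]
    rintro b - ⟨-, h1⟩ ⟨-, h2⟩
    exact hH (h1.trans h2.symm)

/-- On `H ∧ ¬G₁ ∧ ¬G₂`: `F₁ = F` and `F₂ = F`. [this work] -/
theorem feed_eq_of_H (η : BondConfig (Fin n)) (B : Finset (Fin n)) (hH : (openGraph η).Reachable u₁ u₂) :
    (B.filter fun b => ¬ (openGraph η).Reachable o b ∧ (openGraph η).Reachable u₁ b).card =
        (B.filter fun b => ¬ (openGraph η).Reachable o b ∧ ((openGraph η).Reachable u₁ b ∨ (openGraph η).Reachable u₂ b)).card ∧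
      (B.filter fun b => ¬ (openGraph η).Reachable o b ∧ (openGraph η).Reachable u₂ b).card =
        (B.filter fun b => ¬ (openGraph η).Reachable o b ∧ ((openGraph η).Reachable u₁ b ∨ (openGraph η).Reachable u₂ b)).card := by
  constructor
  · congr 1; ext b; simp only [mem_filter]
    constructor
    · rintro ⟨hb, h0, h1⟩; exact ⟨hb, h0, Or.inl h1⟩
    · rintro ⟨hb, h0, h1 | h2⟩
      · exact ⟨hb, h0, h1⟩
      · exact ⟨hb, h0, hH.trans h2⟩
  · congr 1; ext b; simp only [mem_filter]
    constructor
    · rintro ⟨hb, h0, h2⟩; exact ⟨hb, h0, Or.inr h2⟩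
    · rintro ⟨hb, h0, h1 | h2⟩
      · exact ⟨hb, h0, hH.symm.trans h1⟩
      · exact ⟨hb, h0, h2⟩

/-- On `G₁ ∧ G₂` there are no feedback relays: `F = 0`. [this work] -/
theorem feed_eq_zero_of_G₁_G₂ (η : BondConfig (Fin n)) (B : Finset (Fin n)) (h1 : (openGraph η).Reachable o u₁)
    (h2 : (openGraph η).Reachable o u₂) :
    (B.filter fun b => ¬ (openGraph η).Reachable o b ∧ ((openGraph η).Reachable u₁ b ∨ (openGraph η).Reachable u₂ b)).card = 0 := by
  rw [card_eq_zero, filter_eq_empty_iff]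
  rintro b - ⟨h0, h | h⟩
  · exact h0 (h1.trans h)
  · exact h0 (h2.trans h)

/-! ## The pointwise mean bound -/

set_option linter.unusedSimpArgs false in
/-- **`sub` pointwise.**  For every configuration `η`, finset `B` (`n = |B|`) and weights `p, r₁, r₂ ∈ [0,1]`:
`K + p r₁r₂·F + p r₁(1−r₂)·F₁ + p(1−r₁)r₂·F₂ + (1−p)r₁r₂·[G₁∨G₂]·F ≤ Σ_T (f_T n [T∧K=0] + (1 + f_T(n−1)) [T∧K=1] + n [T∧K≥2])`.
[this work] -/
theorem sub_pointwise (η : BondConfig (Fin n)) (B : Finset (Fin n)) {p r₁ r₂ : ℝ} (hp0 : 0 ≤ p) (hp1 : p ≤ 1)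
    (hr10 : 0 ≤ r₁) (hr11 : r₁ ≤ 1) (hr20 : 0 ≤ r₂) (hr21 : r₂ ≤ 1) :
    ((B.filter fun b => η ∈ openConn o b).card : ℝ) +
        p * r₁ * r₂ * (B.filter fun b => ¬ (openGraph η).Reachable o b ∧ ((openGraph η).Reachable u₁ b ∨ (openGraph η).Reachable u₂ b)).card +
        p * r₁ * (1 - r₂) * (B.filter fun b => ¬ (openGraph η).Reachable o b ∧ (openGraph η).Reachable u₁ b).card +
        p * (1 - r₁) * r₂ * (B.filter fun b => ¬ (openGraph η).Reachable o b ∧ (openGraph η).Reachable u₂ b).card +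
        (1 - p) * r₁ * r₂ * (if (openGraph η).Reachable o u₁ ∨ (openGraph η).Reachable o u₂ then
          ((B.filter fun b => ¬ (openGraph η).Reachable o b ∧ ((openGraph η).Reachable u₁ b ∨ (openGraph η).Reachable u₂ b)).card : ℝ)
          else 0) ≤
      -- type T₀ = ¬G₁ ∧ ¬G₂ ∧ ¬H, feed rate p·max(r₁,r₂)
      (p * max r₁ r₂ * B.card * (if (¬ (openGraph η).Reachable o u₁ ∧ ¬ (openGraph η).Reachable o u₂ ∧ ¬ (openGraph η).Reachable u₁ u₂) ∧ (B.filter fun b => η ∈ openConn o b).card = 0 then (1 : ℝ) else 0) +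
        (1 + p * max r₁ r₂ * (B.card - 1)) * (if (¬ (openGraph η).Reachable o u₁ ∧ ¬ (openGraph η).Reachable o u₂ ∧ ¬ (openGraph η).Reachable u₁ u₂) ∧ (B.filter fun b => η ∈ openConn o b).card = 1 then (1 : ℝ) else 0) +
        B.card * (if (¬ (openGraph η).Reachable o u₁ ∧ ¬ (openGraph η).Reachable o u₂ ∧ ¬ (openGraph η).Reachable u₁ u₂) ∧ 2 ≤ (B.filter fun b => η ∈ openConn o b).card then (1 : ℝ) else 0)) +
      -- type T₁ = G₁ ∧ ¬G₂, feed rate (1 − (1−p)(1−r₁))·r₂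
      ((1 - (1 - p) * (1 - r₁)) * r₂ * B.card * (if ((openGraph η).Reachable o u₁ ∧ ¬ (openGraph η).Reachable o u₂) ∧ (B.filter fun b => η ∈ openConn o b).card = 0 then (1 : ℝ) else 0) +
        (1 + (1 - (1 - p) * (1 - r₁)) * r₂ * (B.card - 1)) * (if ((openGraph η).Reachable o u₁ ∧ ¬ (openGraph η).Reachable o u₂) ∧ (B.filter fun b => η ∈ openConn o b).card = 1 then (1 : ℝ) else 0) +
        B.card * (if ((openGraph η).Reachable o u₁ ∧ ¬ (openGraph η).Reachable o u₂) ∧ 2 ≤ (B.filter fun b => η ∈ openConn o b).card then (1 : ℝ) else 0)) +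
      -- type T₂ = G₂ ∧ ¬G₁, feed rate (1 − (1−p)(1−r₂))·r₁
      ((1 - (1 - p) * (1 - r₂)) * r₁ * B.card * (if ((openGraph η).Reachable o u₂ ∧ ¬ (openGraph η).Reachable o u₁) ∧ (B.filter fun b => η ∈ openConn o b).card = 0 then (1 : ℝ) else 0) +
        (1 + (1 - (1 - p) * (1 - r₂)) * r₁ * (B.card - 1)) * (if ((openGraph η).Reachable o u₂ ∧ ¬ (openGraph η).Reachable o u₁) ∧ (B.filter fun b => η ∈ openConn o b).card = 1 then (1 : ℝ) else 0) +
        B.card * (if ((openGraph η).Reachable o u₂ ∧ ¬ (openGraph η).Reachable o u₁) ∧ 2 ≤ (B.filter fun b => η ∈ openConn o b).card then (1 : ℝ) else 0)) +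
      -- type T₃ = ¬G₁ ∧ ¬G₂ ∧ H, feed rate p(1 − (1−r₁)(1−r₂))
      (p * (1 - (1 - r₁) * (1 - r₂)) * B.card * (if (¬ (openGraph η).Reachable o u₁ ∧ ¬ (openGraph η).Reachable o u₂ ∧ (openGraph η).Reachable u₁ u₂) ∧ (B.filter fun b => η ∈ openConn o b).card = 0 then (1 : ℝ) else 0) +
        (1 + p * (1 - (1 - r₁) * (1 - r₂)) * (B.card - 1)) * (if (¬ (openGraph η).Reachable o u₁ ∧ ¬ (openGraph η).Reachable o u₂ ∧ (openGraph η).Reachable u₁ u₂) ∧ (B.filter fun b => η ∈ openConn o b).card = 1 then (1 : ℝ) else 0) +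
        B.card * (if (¬ (openGraph η).Reachable o u₁ ∧ ¬ (openGraph η).Reachable o u₂ ∧ (openGraph η).Reachable u₁ u₂) ∧ 2 ≤ (B.filter fun b => η ∈ openConn o b).card then (1 : ℝ) else 0)) +
      -- type T₄ = G₁ ∧ G₂, no feed
      ((if ((openGraph η).Reachable o u₁ ∧ (openGraph η).Reachable o u₂) ∧ (B.filter fun b => η ∈ openConn o b).card = 1 then (1 : ℝ) else 0) +
        B.card * (if ((openGraph η).Reachable o u₁ ∧ (openGraph η).Reachable o u₂) ∧ 2 ≤ (B.filter fun b => η ∈ openConn o b).card then (1 : ℝ) else 0)) := by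
  -- names
  set K := (B.filter fun b => η ∈ openConn o b).card with hK
  set F := (B.filter fun b => ¬ (openGraph η).Reachable o b ∧ ((openGraph η).Reachable u₁ b ∨ (openGraph η).Reachable u₂ b)).card
    with hF
  set F₁ := (B.filter fun b => ¬ (openGraph η).Reachable o b ∧ (openGraph η).Reachable u₁ b).card with hF1
  set F₂ := (B.filter fun b => ¬ (openGraph η).Reachable o b ∧ (openGraph η).Reachable u₂ b).card with hF2
  have hF10 : (0 : ℝ) ≤ F₁ := Nat.cast_nonneg _
  have hF20 : (0 : ℝ) ≤ F₂ := Nat.cast_nonneg _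
  have hF0 : (0 : ℝ) ≤ F := Nat.cast_nonneg _
  obtain ⟨hF1F, hF2F⟩ := feed_le_feed (o := o) (u₁ := u₁) (u₂ := u₂) η B
  have hF1F' : (F₁ : ℝ) ≤ F := by exact_mod_cast hF1F
  have hF2F' : (F₂ : ℝ) ≤ F := by exact_mod_cast hF2F
  have h1p : 0 ≤ 1 - p := by linarith
  have h1r1 : 0 ≤ 1 - r₁ := by linarith
  have h1r2 : 0 ≤ 1 - r₂ := by linarith
  -- `count_le` at a feed rate `f`
  have CL : ∀ {f : ℝ}, 0 ≤ f → f ≤ 1 → (K : ℝ) + f * F ≤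
      f * B.card * (if K = 0 then (1 : ℝ) else 0) + (1 + f * (B.card - 1)) * (if K = 1 then (1 : ℝ) else 0) +
        B.card * (if 2 ≤ K then (1 : ℝ) else 0) :=
    fun hf0 hf1 => count_le (o := o) (u₁ := u₁) (u₂ := u₂) η B hf0 hf1
  by_cases hG1 : (openGraph η).Reachable o u₁
  · by_cases hG2 : (openGraph η).Reachable o u₂
    · -- T₄
      have hF00 : F = 0 := feed_eq_zero_of_G₁_G₂ (o := o) (u₁ := u₁) (u₂ := u₂) η B hG1 hG2
      have eF : (F : ℝ) = 0 := by exact_mod_cast hF00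
      have eF1 : (F₁ : ℝ) = 0 := by linarith
      have eF2 : (F₂ : ℝ) = 0 := by linarith
      have c0 := CL le_rfl (zero_le_one : (0 : ℝ) ≤ 1)
      simp only [hG1, hG2, not_true_eq_false, not_false_eq_true, true_and, false_and, and_true, and_false, if_true, if_false, true_or, or_true, or_false, false_or, zero_mul, one_mul, mul_zero, mul_one, zero_add, add_zero, eF, eF1, eF2] at c0 ⊢
      linarith
    · -- T₁ : feed rate f₁ = (1 − (1−p)(1−r₁)) r₂, only `F₂`-feeds (`F₁ = 0`, `F = F₂`)
      have hF1z : F₁ = 0 := feed₁_eq_zero_of_G₁ (o := o) (u₁ := u₁) η B hG1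
      have eF1 : (F₁ : ℝ) = 0 := by exact_mod_cast hF1z
      have hf0 : 0 ≤ (1 - (1 - p) * (1 - r₁)) * r₂ := mul_nonneg (by nlinarith [mul_nonneg h1p h1r1]) hr20
      have hf1 : (1 - (1 - p) * (1 - r₁)) * r₂ ≤ 1 := by nlinarith [mul_nonneg h1p h1r1]
      have c1 := CL hf0 hf1
      simp only [hG1, hG2, not_true_eq_false, not_false_eq_true, true_and, false_and, and_true, and_false, if_true, if_false, true_or, or_true, or_false, false_or, zero_mul, one_mul, mul_zero, mul_one, zero_add, add_zero, eF1] at c1 ⊢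
      have key : p * r₁ * r₂ * (F : ℝ) + p * (1 - r₁) * r₂ * F₂ + (1 - p) * r₁ * r₂ * F ≤ (1 - (1 - p) * (1 - r₁)) * r₂ * F := by
        have : p * (1 - r₁) * r₂ * (F₂ : ℝ) ≤ p * (1 - r₁) * r₂ * F := mul_le_mul_of_nonneg_left hF2F' (by positivity)
        nlinarith [this]
      linarith
  · by_cases hG2 : (openGraph η).Reachable o u₂
    · -- T₂
      have hF2z : F₂ = 0 := feed₂_eq_zero_of_G₂ (o := o) (u₂ := u₂) η B hG2
      have eF2 : (F₂ : ℝ) = 0 := by exact_mod_cast hF2z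
      have hf0 : 0 ≤ (1 - (1 - p) * (1 - r₂)) * r₁ := mul_nonneg (by nlinarith [mul_nonneg h1p h1r2]) hr10
      have hf1 : (1 - (1 - p) * (1 - r₂)) * r₁ ≤ 1 := by nlinarith [mul_nonneg h1p h1r2]
      have c1 := CL hf0 hf1
      simp only [hG1, hG2, not_true_eq_false, not_false_eq_true, true_and, false_and, and_true, and_false, if_true, if_false, true_or, or_true, or_false, false_or, zero_mul, one_mul, mul_zero, mul_one, zero_add, add_zero, eF2] at c1 ⊢
      have key : p * r₁ * r₂ * (F : ℝ) + p * r₁ * (1 - r₂) * F₁ + (1 - p) * r₁ * r₂ * F ≤ (1 - (1 - p) * (1 - r₂)) * r₁ * F := by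
        have : p * r₁ * (1 - r₂) * (F₁ : ℝ) ≤ p * r₁ * (1 - r₂) * F := mul_le_mul_of_nonneg_left hF1F' (by positivity)
        nlinarith [this]
      linarith
    · by_cases hH : (openGraph η).Reachable u₁ u₂
      · -- T₃ : `F₁ = F₂ = F`, feed rate p(1 − (1−r₁)(1−r₂))
        obtain ⟨e1, e2⟩ := feed_eq_of_H (o := o) (u₁ := u₁) (u₂ := u₂) η B hH
        have eF1 : (F₁ : ℝ) = F := by exact_mod_cast e1
        have eF2 : (F₂ : ℝ) = F := by exact_mod_cast e2
        have hf0 : 0 ≤ p * (1 - (1 - r₁) * (1 - r₂)) := mul_nonneg hp0 (by nlinarith [mul_nonneg h1r1 h1r2])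
        have hf1 : p * (1 - (1 - r₁) * (1 - r₂)) ≤ 1 := by nlinarith [mul_nonneg h1r1 h1r2]
        have c1 := CL hf0 hf1
        simp only [hH, hG1, hG2, not_true_eq_false, not_false_eq_true, true_and, false_and, and_true, and_false, if_true, if_false, true_or, or_true, or_false, false_or, zero_mul, one_mul, mul_zero, mul_one, zero_add, add_zero, eF1, eF2] at c1 ⊢
        have key : p * r₁ * r₂ * (F : ℝ) + p * r₁ * (1 - r₂) * F + p * (1 - r₁) * r₂ * F = p * (1 - (1 - r₁) * (1 - r₂)) * F := by
          ring
        linarith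
      · -- T₀ : `F₁ + F₂ = F`, feed rate p·max(r₁,r₂)
        have e12 := feed_add_eq_of_not_H (o := o) (u₁ := u₁) (u₂ := u₂) η B hH
        have eF12 : (F₁ : ℝ) + F₂ = F := by exact_mod_cast e12
        have hm0 : 0 ≤ max r₁ r₂ := le_max_of_le_left hr10
        have hm1 : max r₁ r₂ ≤ 1 := max_le hr11 hr21
        have hf0 : 0 ≤ p * max r₁ r₂ := mul_nonneg hp0 hm0
        have hf1 : p * max r₁ r₂ ≤ 1 := by nlinarith
        have c1 := CL hf0 hf1
        simp only [hH, hG1, hG2, not_true_eq_false, not_false_eq_true, true_and, false_and, and_true, and_false, if_true, if_false, true_or, or_true, or_false, false_or, zero_mul, one_mul, mul_zero, mul_one, zero_add, add_zero] at c1 ⊢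
        have key : p * r₁ * r₂ * (F : ℝ) + p * r₁ * (1 - r₂) * F₁ + p * (1 - r₁) * r₂ * F₂ ≤ p * max r₁ r₂ * F := by
          have a1 : r₁ ≤ max r₁ r₂ := le_max_left _ _
          have a2 : r₂ ≤ max r₁ r₂ := le_max_right _ _
          have e : p * r₁ * r₂ * (F : ℝ) + p * r₁ * (1 - r₂) * F₁ + p * (1 - r₁) * r₂ * F₂ =
              p * r₁ * F₁ + p * r₂ * F₂ + p * r₁ * r₂ * (F - F₁ - F₂) := by ring
          rw [e, show (F : ℝ) - F₁ - F₂ = 0 by linarith, mul_zero, add_zero]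
          have b1 : p * r₁ * (F₁ : ℝ) ≤ p * max r₁ r₂ * F₁ :=
            mul_le_mul_of_nonneg_right (mul_le_mul_of_nonneg_left a1 hp0) hF10
          have b2 : p * r₂ * (F₂ : ℝ) ≤ p * max r₁ r₂ * F₂ :=
            mul_le_mul_of_nonneg_right (mul_le_mul_of_nonneg_left a2 hp0) hF20
          nlinarith [b1, b2]
        linarith

/-- `sub_pointwise` in the shape used by the integration of file X: the gated feed as a count, the fourteen cells right-nested.
[this work] -/
theorem sub_pointwise' (η : BondConfig (Fin n)) (B : Finset (Fin n)) {p r₁ r₂ : ℝ} (hp0 : 0 ≤ p) (hp1 : p ≤ 1)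
    (hr10 : 0 ≤ r₁) (hr11 : r₁ ≤ 1) (hr20 : 0 ≤ r₂) (hr21 : r₂ ≤ 1) :
    1 * ((B.filter fun b => η ∈ openConn o b).card : ℝ) + p * (r₁ * r₂) * ((B.filter fun b => ¬ (openGraph η).Reachable o b ∧ ((openGraph η).Reachable u₁ b ∨ (openGraph η).Reachable u₂ b)).card : ℝ) +
        p * (r₁ * (1 - r₂)) * ((B.filter fun b => ¬ (openGraph η).Reachable o b ∧ (openGraph η).Reachable u₁ b).card : ℝ) + p * ((1 - r₁) * r₂) * ((B.filter fun b => ¬ (openGraph η).Reachable o b ∧ (openGraph η).Reachable u₂ b).card : ℝ) +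
        (1 - p) * (r₁ * r₂) * ((B.filter fun b => ¬ (openGraph η).Reachable o b ∧ ((openGraph η).Reachable o u₁ ∨ (openGraph η).Reachable o u₂) ∧ ((openGraph η).Reachable u₁ b ∨ (openGraph η).Reachable u₂ b)).card : ℝ) ≤
      p * max r₁ r₂ * B.card * (if (¬ (openGraph η).Reachable o u₁ ∧ ¬ (openGraph η).Reachable o u₂ ∧ ¬ (openGraph η).Reachable u₁ u₂) ∧ (B.filter fun b => η ∈ openConn o b).card = 0 then (1 : ℝ) else 0) +
      ((1 + p * max r₁ r₂ * (B.card - 1)) * (if (¬ (openGraph η).Reachable o u₁ ∧ ¬ (openGraph η).Reachable o u₂ ∧ ¬ (openGraph η).Reachable u₁ u₂) ∧ (B.filter fun b => η ∈ openConn o b).card = 1 then (1 : ℝ) else 0) +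
      ((B.card : ℝ) * (if (¬ (openGraph η).Reachable o u₁ ∧ ¬ (openGraph η).Reachable o u₂ ∧ ¬ (openGraph η).Reachable u₁ u₂) ∧ 2 ≤ (B.filter fun b => η ∈ openConn o b).card then (1 : ℝ) else 0) +
      ((1 - (1 - p) * (1 - r₁)) * r₂ * B.card * (if ((openGraph η).Reachable o u₁ ∧ ¬ (openGraph η).Reachable o u₂) ∧ (B.filter fun b => η ∈ openConn o b).card = 0 then (1 : ℝ) else 0) +
      ((1 + (1 - (1 - p) * (1 - r₁)) * r₂ * (B.card - 1)) * (if ((openGraph η).Reachable o u₁ ∧ ¬ (openGraph η).Reachable o u₂) ∧ (B.filter fun b => η ∈ openConn o b).card = 1 then (1 : ℝ) else 0) +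
      ((B.card : ℝ) * (if ((openGraph η).Reachable o u₁ ∧ ¬ (openGraph η).Reachable o u₂) ∧ 2 ≤ (B.filter fun b => η ∈ openConn o b).card then (1 : ℝ) else 0) +
      ((1 - (1 - p) * (1 - r₂)) * r₁ * B.card * (if ((openGraph η).Reachable o u₂ ∧ ¬ (openGraph η).Reachable o u₁) ∧ (B.filter fun b => η ∈ openConn o b).card = 0 then (1 : ℝ) else 0) +
      ((1 + (1 - (1 - p) * (1 - r₂)) * r₁ * (B.card - 1)) * (if ((openGraph η).Reachable o u₂ ∧ ¬ (openGraph η).Reachable o u₁) ∧ (B.filter fun b => η ∈ openConn o b).card = 1 then (1 : ℝ) else 0) +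
      ((B.card : ℝ) * (if ((openGraph η).Reachable o u₂ ∧ ¬ (openGraph η).Reachable o u₁) ∧ 2 ≤ (B.filter fun b => η ∈ openConn o b).card then (1 : ℝ) else 0) +
      (p * (1 - (1 - r₁) * (1 - r₂)) * B.card * (if (¬ (openGraph η).Reachable o u₁ ∧ ¬ (openGraph η).Reachable o u₂ ∧ (openGraph η).Reachable u₁ u₂) ∧ (B.filter fun b => η ∈ openConn o b).card = 0 then (1 : ℝ) else 0) +
      ((1 + p * (1 - (1 - r₁) * (1 - r₂)) * (B.card - 1)) * (if (¬ (openGraph η).Reachable o u₁ ∧ ¬ (openGraph η).Reachable o u₂ ∧ (openGraph η).Reachable u₁ u₂) ∧ (B.filter fun b => η ∈ openConn o b).card = 1 then (1 : ℝ) else 0) +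
      ((B.card : ℝ) * (if (¬ (openGraph η).Reachable o u₁ ∧ ¬ (openGraph η).Reachable o u₂ ∧ (openGraph η).Reachable u₁ u₂) ∧ 2 ≤ (B.filter fun b => η ∈ openConn o b).card then (1 : ℝ) else 0) +
      ((1 : ℝ) * (if ((openGraph η).Reachable o u₁ ∧ (openGraph η).Reachable o u₂) ∧ (B.filter fun b => η ∈ openConn o b).card = 1 then (1 : ℝ) else 0) +
      ((B.card : ℝ) * (if ((openGraph η).Reachable o u₁ ∧ (openGraph η).Reachable o u₂) ∧ 2 ≤ (B.filter fun b => η ∈ openConn o b).card then (1 : ℝ) else 0) + 0))))))))))))) := by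
  have hpt := sub_pointwise (o := o) (u₁ := u₁) (u₂ := u₂) η B hp0 hp1 hr10 hr11 hr20 hr21
  by_cases hG : (openGraph η).Reachable o u₁ ∨ (openGraph η).Reachable o u₂
  · rw [if_pos hG] at hpt
    have e : (B.filter fun b => ¬ (openGraph η).Reachable o b ∧ ((openGraph η).Reachable o u₁ ∨ (openGraph η).Reachable o u₂) ∧
          ((openGraph η).Reachable u₁ b ∨ (openGraph η).Reachable u₂ b)) =
        (B.filter fun b => ¬ (openGraph η).Reachable o b ∧ ((openGraph η).Reachable u₁ b ∨ (openGraph η).Reachable u₂ b)) :=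
      filter_congr fun b _ => by simp only [hG, true_and]
    rw [e]
    linarith
  · rw [if_neg hG] at hpt
    have e : (B.filter fun b => ¬ (openGraph η).Reachable o b ∧ ((openGraph η).Reachable o u₁ ∨ (openGraph η).Reachable o u₂) ∧
          ((openGraph η).Reachable u₁ b ∨ (openGraph η).Reachable u₂ b)) = ∅ :=
      filter_eq_empty_iff.2 fun b _ h => hG h.2.1
    rw [e, card_empty, Nat.cast_zero]
    linarith

end Gate3

end Quant

end Summit.CriticalPhenomena.PercolationContinuityZ3.Theorems
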